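import Summits.HodgeConjecture.HodgeConjecture.Theorems.H413E2SWBorelBoundFrameHom
import Literature.NumberTheory.GelbartRogawski1991.UnitaryDualPairThetaKernel
import HarnessLib

/-!
# Crux H413, E-2 child line `F0_E2SiegelWeilWeilRange`, row SW2c-BOUND: (**)′ IN THE δ♮-FRAME WITH (IMPL) DISCHARGED BY THE
# COMPATIBLE SPLITTING OF THE DOUBLED PAIR — `exists_borelBound_CM`

HC_CM is proved only modulo the printed citations until rung 0 closes; nothing in this file is about HC.  Cell `hodgecm-mathlib`,
floor 0, programme P4, engine E-2, item stmt-HodgeConjecture-24833 (`--supports`); seat F0P4-p07 (g3); sheet `F0/P4/SW2c-BOUND-ASSEMBLY.v1`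
(8e2768b2) §B (IMPL), A6 of its landing order (F0P4-plan (g4) «A6 ARCHITECTURE OF RECORD» 05:36:48Z: generic CM context `(F, E, c)`,
`F` totally real, `E/F` quadratic Galois, ARBITRARY symmetric invertible `T_V`, `T_W` of size `1`).

THE STEP ([Weil1965] n° 47 Lemme 20 / n° 50 — the compact factor; [GelbartRogawski1991] §3.1 Prop. 3.1.1, §3.2 p. 457 — the
splitting over the unitary dual pair): ★ A6a `E2SWBorelBoundFrameHom.exists_borelBound_frame_of_hom` reads the implementers of the
compact part from ANY coefficient-continuous hom `s : U_D → Mp` over `spReindex ∘ jS`.  Here `s` IS the compatible splitting of the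
metaplectic extension over the DOUBLED dual pair `(U(T_V), U(T_W ⊕ −T_W))` in the doubled enumeration `e_D` — a continuous `s₀` on
`U(T_V ⊗ (T_W ⊕ −T_W))(𝔸_F)` with `π ∘ s₀ = ι` (hypotheses `s₀`, `hsc`, `hcompat`; it EXISTS unconditionally, ★
`UnitaryDualPair.compatibleSplitting_splittingDatum … (1+1) e_D …`, kernel-checked [GelbartRogawski1991] Prop. 3.1.1 of the tree) — whose
pair splitting `s_pair(x, y) = s₀(x ⊗ 1) s₀(1 ⊗ y)` (★ `pairSplitting`) is cast along the Gram identity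
`adelicGram e_D T_V (T_W ⊕ −T_W) = 𝕋` (hypothesis `hTe`, ★ `Li1992.DoubledPair.adelicGram_eD_eq_doubledGramFin`) and restricted to
`1 × U_D`: `s := (hTe ▸ s_pair) ∘ inr`.  Its coefficient continuity is ★ `continuous_pairSplitting` (`continuous_coe_cast_pairSplitting_inr`),
and `π(s(1,k)) = ι(1 ⊗ k)` is ★ `proj_pairSplitting` (`proj_cast_pairSplitting_inr_apply`, the `hproj` letter of A6a read through the pair
embedding exactly as `hjS`); both by `subst` along a variable Gram matrix.  What remains of (IMPL)+(DOM-C) is the domination letter `hdom`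
ALONE, now at this explicit `s` (the theta-majorant adapter `E2SWBorelBoundLettersCM.hdom_CM` of F0P4-p05).

THE THEOREM `exists_borelBound_CM`: ★ `exists_borelBound_frame_of_hom` with `(s, hs, hproj)` DISCHARGED; hypotheses left: (INV) `hINV`,
(DOM-C) `hdom`, the (Î)/(E_X) structure letters, and the data `u₀, jS, s₀` (all three ★-obtainable: `exists_frameUnipPair`,
`exists_sumModelHom`, `compatibleSplitting_splittingDatum`).

References: A. Weil, Acta Math. 113 (1965), n° 47 Lemme 20, n° 50 [Weil1965]; A. Weil, Acta Math. 111 (1964), Chap. I n° 13 p. 160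
[Weil1964]; S. Gelbart, J. Rogawski, Invent. Math. 105 (1991), §3.1 Prop. 3.1.1 p. 455, §3.2 p. 457 [GelbartRogawski1991]; J.-S. Li,
J. reine angew. Math. 428 (1992), p. 181 [Li1992].
-/

set_option autoImplicit false

noncomputable section

set_option linter.dupNamespace false

namespace Summit.HodgeConjecture.HodgeConjecture.Cruxes.H413.E2SWBorelBoundSplitting

open scoped NNReal ENNReal Matrix
open _root_.MeasureTheory NumberField IsDedekindDomain Matrix
open Literature.RepresentationTheory.HeisenbergGroup
open Literature.NumberTheory.Weil1964 Literature.NumberTheory.Weil1965 Literature.NumberTheory.Automorphic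
open Literature.NumberTheory.Automorphic.DoubledUnitary.RankOneReduction
open Literature.NumberTheory.Automorphic.UnitaryGroup
open Literature.NumberTheory.GelbartRogawski1991 Literature.NumberTheory.GelbartRogawski1991.UnitaryDualPair

variable (F E : Type) [Field F] [NumberField F] [Field E] [NumberField E] [Algebra F E] [Algebra.IsQuadraticExtension F E]
  (c : E ≃ₐ[F] E) {δ : E} (hcδ : c δ = -δ) (hδ : δ ≠ 0) {d : F} (hd : δ * δ = algebraMap F E d)
  (N : ℕ) {n : ℕ} (e : Fin N × Fin 1 ≃ Fin n)
  {TV : Matrix (Fin N) (Fin N) F} (TW : Matrix (Fin 1) (Fin 1) F) (hV : TV.IsSymm)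
  (hW2 : (Matrix.reindex finSumFinEquiv finSumFinEquiv (Matrix.fromBlocks TW 0 0 (-TW))).IsSymm)
  (hVd : IsUnit TV.det) (hWd : IsUnit TW.det)

omit [Algebra.IsQuadraticExtension F E] in
/-- **coefficient continuity of the cast pair splitting on `1 × U_D`** (★ `continuous_pairSplitting`, by `subst` along a variable Gram
matrix `T′`). [cite: GelbartRogawski1991, §3.1 Prop. 3.1.1 p. 455 L1–3] -/
theorem continuous_coe_cast_pairSplitting_inr {T' : Matrix (Fin (n + n)) (Fin (n + n)) (AdeleRing (𝓞 F) F)}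
    (hTe : adelicGram F
        (((Equiv.prodCongr (Equiv.refl (Fin N)) finSumFinEquiv.symm).trans (Equiv.prodSumDistrib (Fin N) (Fin 1) (Fin 1))).trans
            ((Equiv.sumCongr e e).trans finSumFinEquiv)) TV
        (Matrix.reindex finSumFinEquiv finSumFinEquiv (Matrix.fromBlocks TW 0 0 (-TW))) = T')
    (s₀ : UnitaryGroup.adelicPair F E c N (1 + 1) (TV.map (algebraMap F E))
        ((Matrix.reindex finSumFinEquiv finSumFinEquiv (Matrix.fromBlocks TW 0 0 (-TW))).map (algebraMap F E)) →*
      adelicMpCont F (Fin (n + n)) (adelicGram F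
        (((Equiv.prodCongr (Equiv.refl (Fin N)) finSumFinEquiv.symm).trans (Equiv.prodSumDistrib (Fin N) (Fin 1) (Fin 1))).trans
            ((Equiv.sumCongr e e).trans finSumFinEquiv)) TV
        (Matrix.reindex finSumFinEquiv finSumFinEquiv (Matrix.fromBlocks TW 0 0 (-TW)))))
    (hsc : Continuous s₀) :
    Continuous fun A : ↥(UnitaryGroup.adelic F E c (1 + 1)
        ((Matrix.reindex finSumFinEquiv finSumFinEquiv (Matrix.fromBlocks TW 0 0 (-TW))).map (algebraMap F E))) =>
      (((hTe ▸ pairSplitting F E c N (1 + 1)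
          (((Equiv.prodCongr (Equiv.refl (Fin N)) finSumFinEquiv.symm).trans (Equiv.prodSumDistrib (Fin N) (Fin 1) (Fin 1))).trans
            ((Equiv.sumCongr e e).trans finSumFinEquiv))
          (TV.map (algebraMap F E)) ((Matrix.reindex finSumFinEquiv finSumFinEquiv (Matrix.fromBlocks TW 0 0 (-TW))).map (algebraMap F E)) s₀ :
          ↥(UnitaryGroup.adelic F E c N (TV.map (algebraMap F E))) × ↥(UnitaryGroup.adelic F E c (1 + 1)
        ((Matrix.reindex finSumFinEquiv finSumFinEquiv (Matrix.fromBlocks TW 0 0 (-TW))).map (algebraMap F E))) →* adelicMpCont F (Fin (n + n)) (T')).comp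
          (MonoidHom.inr _ _) A : adelicMpCont F (Fin (n + n)) T') : adelicMp F (Fin (n + n)) T') := by
  subst hTe
  exact continuous_subtype_val.comp ((continuous_pairSplitting F E c N (1 + 1)
    (((Equiv.prodCongr (Equiv.refl (Fin N)) finSumFinEquiv.symm).trans (Equiv.prodSumDistrib (Fin N) (Fin 1) (Fin 1))).trans ((Equiv.sumCongr e e).trans finSumFinEquiv))
    (TV.map (algebraMap F E)) ((Matrix.reindex finSumFinEquiv finSumFinEquiv (Matrix.fromBlocks TW 0 0 (-TW))).map (algebraMap F E)) hsc).comp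
    (continuous_const.prodMk continuous_id))

/-- **`π(s(1, k)) = ι(1 ⊗ k)` for the cast pair splitting**, pointwise on `𝕎□_𝔸` (★ `proj_pairSplitting` at `(1, k)`, `subst` along a
variable Gram matrix; the `hproj` letter of ★ `exists_borelBound_frame_of_hom`). [cite: GelbartRogawski1991, §3.1 Prop. 3.1.1 p. 455 L1–3] -/
theorem proj_cast_pairSplitting_inr_apply
    (hWDd : IsUnit (Matrix.reindex finSumFinEquiv finSumFinEquiv (Matrix.fromBlocks TW 0 0 (-TW))).det)
    {T' : Matrix (Fin (n + n)) (Fin (n + n)) (AdeleRing (𝓞 F) F)}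
    (hTe : adelicGram F
        (((Equiv.prodCongr (Equiv.refl (Fin N)) finSumFinEquiv.symm).trans (Equiv.prodSumDistrib (Fin N) (Fin 1) (Fin 1))).trans
            ((Equiv.sumCongr e e).trans finSumFinEquiv)) TV
        (Matrix.reindex finSumFinEquiv finSumFinEquiv (Matrix.fromBlocks TW 0 0 (-TW))) = T')
    (s₀ : UnitaryGroup.adelicPair F E c N (1 + 1) (TV.map (algebraMap F E))
        ((Matrix.reindex finSumFinEquiv finSumFinEquiv (Matrix.fromBlocks TW 0 0 (-TW))).map (algebraMap F E)) →*
      adelicMpCont F (Fin (n + n)) (adelicGram F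
        (((Equiv.prodCongr (Equiv.refl (Fin N)) finSumFinEquiv.symm).trans (Equiv.prodSumDistrib (Fin N) (Fin 1) (Fin 1))).trans
            ((Equiv.sumCongr e e).trans finSumFinEquiv)) TV
        (Matrix.reindex finSumFinEquiv finSumFinEquiv (Matrix.fromBlocks TW 0 0 (-TW)))))
    (hcompat : (splittingDatum F E c N (1 + 1)
        (((Equiv.prodCongr (Equiv.refl (Fin N)) finSumFinEquiv.symm).trans (Equiv.prodSumDistrib (Fin N) (Fin 1) (Fin 1))).trans
            ((Equiv.sumCongr e e).trans finSumFinEquiv))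
        (TV.map (algebraMap F E)) ((Matrix.reindex finSumFinEquiv finSumFinEquiv (Matrix.fromBlocks TW 0 0 (-TW))).map (algebraMap F E))
        hcδ hδ hd hV hW2 hVd hWDd rfl rfl).IsCompatible s₀)
    (A : ↥(UnitaryGroup.adelic F E c (1 + 1)
        ((Matrix.reindex finSumFinEquiv finSumFinEquiv (Matrix.fromBlocks TW 0 0 (-TW))).map (algebraMap F E))))
    (v : ((Fin (n + n) → AdeleRing (𝓞 F) F) × (Fin (n + n) → AdeleRing (𝓞 F) F))) :
    ((adelicMpCont.proj F (Fin (n + n)) T'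
          ((hTe ▸ pairSplitting F E c N (1 + 1)
          (((Equiv.prodCongr (Equiv.refl (Fin N)) finSumFinEquiv.symm).trans (Equiv.prodSumDistrib (Fin N) (Fin 1) (Fin 1))).trans
            ((Equiv.sumCongr e e).trans finSumFinEquiv))
          (TV.map (algebraMap F E)) ((Matrix.reindex finSumFinEquiv finSumFinEquiv (Matrix.fromBlocks TW 0 0 (-TW))).map (algebraMap F E)) s₀ :
          ↥(UnitaryGroup.adelic F E c N (TV.map (algebraMap F E))) × ↥(UnitaryGroup.adelic F E c (1 + 1)
        ((Matrix.reindex finSumFinEquiv finSumFinEquiv (Matrix.fromBlocks TW 0 0 (-TW))).map (algebraMap F E))) →* adelicMpCont F (Fin (n + n)) (T')).comp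
            (MonoidHom.inr _ _) A) : symplecticGroup (polar (adelicForm F (Fin (n + n)) T'))) :
        ((Fin (n + n) → AdeleRing (𝓞 F) F) × (Fin (n + n) → AdeleRing (𝓞 F) F)) ≃ₗ[AdeleRing (𝓞 F) F]
          ((Fin (n + n) → AdeleRing (𝓞 F) F) × (Fin (n + n) → AdeleRing (𝓞 F) F))) v =
      ((toSp F E c N (1 + 1)
          (((Equiv.prodCongr (Equiv.refl (Fin N)) finSumFinEquiv.symm).trans (Equiv.prodSumDistrib (Fin N) (Fin 1) (Fin 1))).trans
            ((Equiv.sumCongr e e).trans finSumFinEquiv))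
          (TV.map (algebraMap F E)) ((Matrix.reindex finSumFinEquiv finSumFinEquiv (Matrix.fromBlocks TW 0 0 (-TW))).map (algebraMap F E))
          hcδ hδ hd hV hW2 rfl rfl
          (adelicInr F E c N (1 + 1) (TV.map (algebraMap F E))
            ((Matrix.reindex finSumFinEquiv finSumFinEquiv (Matrix.fromBlocks TW 0 0 (-TW))).map (algebraMap F E)) A) :
          symplecticGroup (polar (adelicForm F (Fin (n + n))
            (adelicGram F
              (((Equiv.prodCongr (Equiv.refl (Fin N)) finSumFinEquiv.symm).trans (Equiv.prodSumDistrib (Fin N) (Fin 1) (Fin 1))).trans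
            ((Equiv.sumCongr e e).trans finSumFinEquiv)) TV
              (Matrix.reindex finSumFinEquiv finSumFinEquiv (Matrix.fromBlocks TW 0 0 (-TW))))))) :
        ((Fin (n + n) → AdeleRing (𝓞 F) F) × (Fin (n + n) → AdeleRing (𝓞 F) F)) ≃ₗ[AdeleRing (𝓞 F) F]
          ((Fin (n + n) → AdeleRing (𝓞 F) F) × (Fin (n + n) → AdeleRing (𝓞 F) F))) v := by
  subst hTe
  have h := proj_pairSplitting F E c N (1 + 1)
    (((Equiv.prodCongr (Equiv.refl (Fin N)) finSumFinEquiv.symm).trans (Equiv.prodSumDistrib (Fin N) (Fin 1) (Fin 1))).trans ((Equiv.sumCongr e e).trans finSumFinEquiv))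
    (TV.map (algebraMap F E)) ((Matrix.reindex finSumFinEquiv finSumFinEquiv (Matrix.fromBlocks TW 0 0 (-TW))).map (algebraMap F E)) hcδ hδ hd hV hW2 hVd hWDd rfl rfl hcompat (1, A)
  simp only [map_one, one_mul] at h
  exact congrArg (fun g : ↥(symplecticGroup (polar (adelicForm F (Fin (n + n)) (adelicGram F
      (((Equiv.prodCongr (Equiv.refl (Fin N)) finSumFinEquiv.symm).trans (Equiv.prodSumDistrib (Fin N) (Fin 1) (Fin 1))).trans ((Equiv.sumCongr e e).trans finSumFinEquiv)) TV
      (Matrix.reindex finSumFinEquiv finSumFinEquiv (Matrix.fromBlocks TW 0 0 (-TW))))))) =>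
    ((g : ((Fin (n + n) → AdeleRing (𝓞 F) F) × (Fin (n + n) → AdeleRing (𝓞 F) F)) ≃ₗ[AdeleRing (𝓞 F) F] ((Fin (n + n) → AdeleRing (𝓞 F) F) × (Fin (n + n) → AdeleRing (𝓞 F) F)))) v) h

omit [Algebra.IsQuadraticExtension F E] in
/-- the domination letter over `1 × U_D`, read through `s′ ∘ inr` (definitional bookkeeping `(s′ ∘ inr)(k) = s′(1, k)`, isolated so that it
is not unfolded inside the frame theorem). [folklore] -/
theorem dominated_comp_inr (Φ : piSchwartzBruhat F (Fin (n + n))) (u : adelicMpCont F (Fin (n + n)) (doubledGramFin F (adelicGram F e TV TW)))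
    (s' : ↥(UnitaryGroup.adelic F E c N (TV.map (algebraMap F E))) × ↥(UnitaryGroup.adelic F E c (1 + 1)
        ((Matrix.reindex finSumFinEquiv finSumFinEquiv (Matrix.fromBlocks TW 0 0 (-TW))).map (algebraMap F E))) →*
      adelicMpCont F (Fin (n + n)) (doubledGramFin F (adelicGram F e TV TW)))
    (hdom : ∀ C' : Set ↥(UnitaryGroup.adelic F E c (1 + 1)
        ((Matrix.reindex finSumFinEquiv finSumFinEquiv (Matrix.fromBlocks TW 0 0 (-TW))).map (algebraMap F E))), IsCompact C' →
      ∃ Φ₀ : piSchwartzBruhat F (Fin (n + n)), ∀ A ∈ C', ∀ x,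
        ‖((adelicMpCont.omega F (Fin (n + n)) (doubledGramFin F (adelicGram F e TV TW)) (u * s' (1, A) * u⁻¹) Φ : piSchwartzBruhat F (Fin (n + n))) :
            (Fin (n + n) → AdeleRing (𝓞 F) F) → ℂ) x‖ ≤
          (((Φ₀ : piSchwartzBruhat F (Fin (n + n))) : (Fin (n + n) → AdeleRing (𝓞 F) F) → ℂ) x).re) :
    ∀ C' : Set ↥(UnitaryGroup.adelic F E c (1 + 1)
        ((Matrix.reindex finSumFinEquiv finSumFinEquiv (Matrix.fromBlocks TW 0 0 (-TW))).map (algebraMap F E))), IsCompact C' →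
      ∃ Φ₀ : piSchwartzBruhat F (Fin (n + n)), ∀ A ∈ C', ∀ x,
        ‖((adelicMpCont.omega F (Fin (n + n)) (doubledGramFin F (adelicGram F e TV TW)) (u * (s'.comp (MonoidHom.inr _ _)) A * u⁻¹) Φ : piSchwartzBruhat F (Fin (n + n))) :
            (Fin (n + n) → AdeleRing (𝓞 F) F) → ℂ) x‖ ≤
          (((Φ₀ : piSchwartzBruhat F (Fin (n + n))) : (Fin (n + n) → AdeleRing (𝓞 F) F) → ℂ) x).re :=
  hdom

set_option maxHeartbeats 400000 in
/-- **(**)′ IN THE δ♮-FRAME WITH (RAY) AND (IMPL) DISCHARGED** — the implementers of the compact part are the compatible splitting of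
the doubled dual pair, conjugated into the frame.  See the module docstring.  Conclusion: one constant `M` with `‖E″(ω(p)Φ)‖ ≤ M · √L(p)`
for every `p ∈ Mp` over `j b`, `b ∈ U_D` Borel. [cite: Weil1965, n° 47 Lemme 20, n° 50] [cite: Weil1964, Chap. I n° 13 p. 160]
[cite: GelbartRogawski1991, §3.1 Prop. 3.1.1 p. 455 L1–3] [cite: Li1992, p. 181] -/
theorem exists_borelBound_CM [IsTotallyReal F] [IsGalois F E] (h2 : ∀ σ : E ≃ₐ[F] E, σ = 1 ∨ σ = c) (hTW : TW 0 0 ≠ 0)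
    (hTs : (adelicGram F e TV TW).IsSymm)
    [MeasurableSpace (AdeleRing (𝓞 F) F)] [BorelSpace (AdeleRing (𝓞 F) F)]
    (ν : Measure (Fin (n + n) → AdeleRing (𝓞 F) F)) [ν.IsAddHaarMeasure]
    (E'' : piSchwartzBruhat F (Fin (n + n)) →ₗ[ℂ] ℂ) (Φ : piSchwartzBruhat F (Fin (n + n)))
    -- the frame chirp as an element of `Mp` (★ `exists_frameUnipPair`)
    (u₀ : adelicMpCont F (Fin (n + n)) (doubledGramFin F (adelicGram F e TV TW)))
    (hu₀ : ∀ Ψ : piSchwartzBruhat F (Fin (n + n)),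
      ((adelicMpCont.omega F (Fin (n + n)) (doubledGramFin F (adelicGram F e TV TW)) u₀ Ψ : piSchwartzBruhat F (Fin (n + n))) :
          (Fin (n + n) → AdeleRing (𝓞 F) F) → ℂ) =
        chirp F (ratMatrix F (frameHalfRat F)) (Ψ : (Fin (n + n) → AdeleRing (𝓞 F) F) → ℂ))
    -- the `W`-side hom into the sum model (★ `exists_sumModelHom`, first conjunct)
    (jS : ↥(UnitaryGroup.adelic F E c (1 + 1)
        ((Matrix.reindex finSumFinEquiv finSumFinEquiv (Matrix.fromBlocks TW 0 0 (-TW))).map (algebraMap F E))) →*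
      ↥(symplecticGroup (polar (Matrix.toLinearMap₂' (AdeleRing (𝓞 F) F)
        (Matrix.fromBlocks (adelicGram F e TV TW) 0 0 (-adelicGram F e TV TW))))))
    (hjS : ∀ (A : ↥(UnitaryGroup.adelic F E c (1 + 1)
        ((Matrix.reindex finSumFinEquiv finSumFinEquiv (Matrix.fromBlocks TW 0 0 (-TW))).map (algebraMap F E))))
        (v : (Fin (n + n) → AdeleRing (𝓞 F) F) × (Fin (n + n) → AdeleRing (𝓞 F) F)),
      ((spReindex (finSumFinEquiv : Fin n ⊕ Fin n ≃ Fin (n + n))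
          (Matrix.fromBlocks (adelicGram F e TV TW) 0 0 (-adelicGram F e TV TW)) (jS A) :
          symplecticGroup (polar (Matrix.toLinearMap₂' (AdeleRing (𝓞 F) F)
            (Matrix.reindex finSumFinEquiv finSumFinEquiv
              (Matrix.fromBlocks (adelicGram F e TV TW) 0 0 (-adelicGram F e TV TW)))))) :
        ((Fin (n + n) → AdeleRing (𝓞 F) F) × (Fin (n + n) → AdeleRing (𝓞 F) F)) ≃ₗ[AdeleRing (𝓞 F) F]
          ((Fin (n + n) → AdeleRing (𝓞 F) F) × (Fin (n + n) → AdeleRing (𝓞 F) F))) v =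
      ((toSp F E c N (1 + 1)
          (((Equiv.prodCongr (Equiv.refl (Fin N)) finSumFinEquiv.symm).trans (Equiv.prodSumDistrib (Fin N) (Fin 1) (Fin 1))).trans
            ((Equiv.sumCongr e e).trans finSumFinEquiv))
          (TV.map (algebraMap F E)) ((Matrix.reindex finSumFinEquiv finSumFinEquiv (Matrix.fromBlocks TW 0 0 (-TW))).map (algebraMap F E))
          hcδ hδ hd hV hW2 rfl rfl
          (adelicInr F E c N (1 + 1) (TV.map (algebraMap F E))
            ((Matrix.reindex finSumFinEquiv finSumFinEquiv (Matrix.fromBlocks TW 0 0 (-TW))).map (algebraMap F E)) A) :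
          symplecticGroup (polar (adelicForm F (Fin (n + n))
            (adelicGram F
              (((Equiv.prodCongr (Equiv.refl (Fin N)) finSumFinEquiv.symm).trans (Equiv.prodSumDistrib (Fin N) (Fin 1) (Fin 1))).trans
                ((Equiv.sumCongr e e).trans finSumFinEquiv)) TV
              (Matrix.reindex finSumFinEquiv finSumFinEquiv (Matrix.fromBlocks TW 0 0 (-TW))))))) :
        ((Fin (n + n) → AdeleRing (𝓞 F) F) × (Fin (n + n) → AdeleRing (𝓞 F) F)) ≃ₗ[AdeleRing (𝓞 F) F]
          ((Fin (n + n) → AdeleRing (𝓞 F) F) × (Fin (n + n) → AdeleRing (𝓞 F) F))) v)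
    -- THE HOM OF RECORD `j = conj(π u₀ · π(doublingDeltaLift)) ∘ spReindex ∘ jS`
    (j : ↥(UnitaryGroup.adelic F E c (1 + 1)
        ((Matrix.reindex finSumFinEquiv finSumFinEquiv (Matrix.fromBlocks TW 0 0 (-TW))).map (algebraMap F E))) →*
      ↥(symplecticGroup (polar (adelicForm F (Fin (n + n)) (doubledGramFin F (adelicGram F e TV TW))))))
    (hj : j = (MulAut.conj (adelicMpCont.proj F (Fin (n + n)) (doubledGramFin F (adelicGram F e TV TW)) u₀ *
        adelicMpCont.proj F (Fin (n + n)) (doubledGramFin F (adelicGram F e TV TW))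
          (doublingDeltaLift F (adelicGram F e TV TW) (isUnit_det_adelicGram F e hVd hWd)))).toMonoidHom.comp
      ((spReindex (finSumFinEquiv : Fin n ⊕ Fin n ≃ Fin (n + n))
        (Matrix.fromBlocks (adelicGram F e TV TW) 0 0 (-adelicGram F e TV TW))).comp jS))
    -- (INV): rational elements have isometric `E″`-invariant lifts over `j`
    (hINV : ∀ (γ : GL (Fin (1 + 1)) (AdeleRing (𝓞 E) E))
      (hγ : γ ∈ UnitaryGroup.adelic F E c (1 + 1)
        ((Matrix.reindex finSumFinEquiv finSumFinEquiv (Matrix.fromBlocks TW 0 0 (-TW))).map (algebraMap F E))),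
      γ ∈ (Matrix.GeneralLinearGroup.map (algebraMap E (AdeleRing (𝓞 E) E))).range →
      ∃ r : adelicMpCont F (Fin (n + n)) (doubledGramFin F (adelicGram F e TV TW)),
        adelicMpCont.proj F (Fin (n + n)) (doubledGramFin F (adelicGram F e TV TW)) r = j ⟨γ, hγ⟩ ∧
        adelicMpCont.l2Scaling F (doubledGramFin F (adelicGram F e TV TW))
          (isUnit_det_doubledGramFin F (adelicGram F e TV TW) (isUnit_det_adelicGram F e hVd hWd)) ν r = 1 ∧
        E'' ∘ₗ adelicMpCont.omega F (Fin (n + n)) (doubledGramFin F (adelicGram F e TV TW)) r⁻¹ = E'')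
    -- (IMPL) FROM A COMPATIBLE SPLITTING OF THE DOUBLED PAIR `(U(T_V), U(T_W ⊕ −T_W))` ([GelbartRogawski1991] Prop. 3.1.1, ★
    -- `compatibleSplitting_splittingDatum` at `M = 1+1`): a continuous compatible splitting `s₀`, cast along the Gram identity `hTe`
    -- (★ `Li1992.DoubledPair.adelicGram_eD_eq_doubledGramFin`) and restricted to `1 × U_D`
    (hWDd : IsUnit (Matrix.reindex finSumFinEquiv finSumFinEquiv (Matrix.fromBlocks TW 0 0 (-TW))).det)
    (s₀ : UnitaryGroup.adelicPair F E c N (1 + 1) (TV.map (algebraMap F E))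
        ((Matrix.reindex finSumFinEquiv finSumFinEquiv (Matrix.fromBlocks TW 0 0 (-TW))).map (algebraMap F E)) →*
      adelicMpCont F (Fin (n + n)) (adelicGram F
        (((Equiv.prodCongr (Equiv.refl (Fin N)) finSumFinEquiv.symm).trans (Equiv.prodSumDistrib (Fin N) (Fin 1) (Fin 1))).trans
            ((Equiv.sumCongr e e).trans finSumFinEquiv)) TV
        (Matrix.reindex finSumFinEquiv finSumFinEquiv (Matrix.fromBlocks TW 0 0 (-TW)))))
    (hsc : Continuous s₀)
    (hcompat : (splittingDatum F E c N (1 + 1)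
        (((Equiv.prodCongr (Equiv.refl (Fin N)) finSumFinEquiv.symm).trans (Equiv.prodSumDistrib (Fin N) (Fin 1) (Fin 1))).trans
            ((Equiv.sumCongr e e).trans finSumFinEquiv))
        (TV.map (algebraMap F E)) ((Matrix.reindex finSumFinEquiv finSumFinEquiv (Matrix.fromBlocks TW 0 0 (-TW))).map (algebraMap F E))
        hcδ hδ hd hV hW2 hVd hWDd rfl rfl).IsCompatible s₀)
    (hTe : adelicGram F
        (((Equiv.prodCongr (Equiv.refl (Fin N)) finSumFinEquiv.symm).trans (Equiv.prodSumDistrib (Fin N) (Fin 1) (Fin 1))).trans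
            ((Equiv.sumCongr e e).trans finSumFinEquiv)) TV
        (Matrix.reindex finSumFinEquiv finSumFinEquiv (Matrix.fromBlocks TW 0 0 (-TW))) = doubledGramFin F (adelicGram F e TV TW))
    -- (DOM-C): ONE dominating Schwartz–Bruhat function for `ω(ũ · s(1,k) · ũ⁻¹)Φ` over every compact subset of `U_D`, `ũ = u₀ · doublingDeltaLift`
    (hdom : ∀ C' : Set ↥(UnitaryGroup.adelic F E c (1 + 1)
        ((Matrix.reindex finSumFinEquiv finSumFinEquiv (Matrix.fromBlocks TW 0 0 (-TW))).map (algebraMap F E))), IsCompact C' →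
      ∃ Φ₀ : piSchwartzBruhat F (Fin (n + n)), ∀ A ∈ C', ∀ x,
        ‖((adelicMpCont.omega F (Fin (n + n)) (doubledGramFin F (adelicGram F e TV TW))
              (u₀ * doublingDeltaLift F (adelicGram F e TV TW) (isUnit_det_adelicGram F e hVd hWd) *
                (hTe ▸ pairSplitting F E c N (1 + 1)
          (((Equiv.prodCongr (Equiv.refl (Fin N)) finSumFinEquiv.symm).trans (Equiv.prodSumDistrib (Fin N) (Fin 1) (Fin 1))).trans
            ((Equiv.sumCongr e e).trans finSumFinEquiv))
          (TV.map (algebraMap F E)) ((Matrix.reindex finSumFinEquiv finSumFinEquiv (Matrix.fromBlocks TW 0 0 (-TW))).map (algebraMap F E)) s₀ :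
          ↥(UnitaryGroup.adelic F E c N (TV.map (algebraMap F E))) × ↥(UnitaryGroup.adelic F E c (1 + 1)
        ((Matrix.reindex finSumFinEquiv finSumFinEquiv (Matrix.fromBlocks TW 0 0 (-TW))).map (algebraMap F E))) →* adelicMpCont F (Fin (n + n)) (doubledGramFin F (adelicGram F e TV TW))) (1, A) *
                (u₀ * doublingDeltaLift F (adelicGram F e TV TW) (isUnit_det_adelicGram F e hVd hWd))⁻¹) Φ : piSchwartzBruhat F (Fin (n + n))) :
            (Fin (n + n) → AdeleRing (𝓞 F) F) → ℂ) x‖ ≤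
          (((Φ₀ : piSchwartzBruhat F (Fin (n + n))) : (Fin (n + n) → AdeleRing (𝓞 F) F) → ℂ) x).re)
    -- the (Î)/(E_X) structure of `E″`
    {Sr : Matrix (Fin (n + n)) (Fin (n + n)) F} (hSr : Sr.IsSymm) (hSrdet : Sr.det ≠ 0)
    (EI EE : piSchwartzBruhat F (Fin (n + n)) →ₗ[ℂ] ℂ) (κ : ℝ≥0∞) (hκ : κ ≠ ⊤)
    (hsplit : ∀ Ψ : piSchwartzBruhat F (Fin (n + n)), (‖E'' Ψ‖ₑ : ℝ≥0∞) ≤ ‖EI Ψ‖ₑ + κ * ‖EE Ψ‖ₑ)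
    {ι : Type*} (Ω : Set ι) (L : ι → GL (Fin (n + n)) (AdeleRing (𝓞 F) F)) (cI : ℝ≥0∞) (hcI : cI ≠ ⊤)
    (hI : ∀ (Ψ : piSchwartzBruhat F (Fin (n + n))) (B : ℝ≥0∞),
      (∀ h ∈ Ω, ∑' v : ↥{v : Fin (n + n) → F | v ≠ 0},
        (‖(Ψ : (Fin (n + n) → AdeleRing (𝓞 F) F) → ℂ) (ratVec F (v : Fin (n + n) → F) ᵥ*
          (L h : Matrix (Fin (n + n)) (Fin (n + n)) (AdeleRing (𝓞 F) F)))‖ₑ : ℝ≥0∞) ≤ B) → (‖EI Ψ‖ₑ : ℝ≥0∞) ≤ cI * B)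
    {𝒴 : Set (GL (Fin (n + n)) (FiniteAdeleRing (𝓞 F) F))} (h𝒴 : IsCompact 𝒴) {H₀ : ℝ}
    (hL : ∀ h ∈ Ω, GLn.sndHom (n + n) F (L h) ∈ 𝒴 ∧ (GLn.archHeight (n + n) F (L h) : ℝ) ≤ H₀)
    (hEE : ∀ Ψ : piSchwartzBruhat F (Fin (n + n)), (‖EE Ψ‖ₑ : ℝ≥0∞) ≤
      ∑' ξ : F, (‖∫ x, chirp F ((algebraMap F (AdeleRing (𝓞 F) F) ξ) • ratMatrix F Sr)
        ((Ψ : piSchwartzBruhat F (Fin (n + n))) : (Fin (n + n) → AdeleRing (𝓞 F) F) → ℂ) x ∂ν‖ₑ : ℝ≥0∞))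
    (hEEmono : ∀ Ψ Ψ' : piSchwartzBruhat F (Fin (n + n)),
      (∀ x, ‖(Ψ : (Fin (n + n) → AdeleRing (𝓞 F) F) → ℂ) x‖ ≤ ((Ψ' : (Fin (n + n) → AdeleRing (𝓞 F) F) → ℂ) x).re) →
        (‖EE Ψ‖ₑ : ℝ≥0∞) ≤ ‖EE Ψ'‖ₑ)
    (hn : 2 < n) :
    ∃ Mbound : ℝ, ∀ (p : adelicMpCont F (Fin (n + n)) (doubledGramFin F (adelicGram F e TV TW)))
      (b : GL (Fin (1 + 1)) (AdeleRing (𝓞 E) E))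
      (hb : b ∈ UnitaryGroup.adelic F E c (1 + 1)
        ((Matrix.reindex finSumFinEquiv finSumFinEquiv (Matrix.fromBlocks TW 0 0 (-TW))).map (algebraMap F E))),
      (b : Matrix (Fin (1 + 1)) (Fin (1 + 1)) (AdeleRing (𝓞 E) E)) 0 0 + (b : Matrix (Fin (1 + 1)) (Fin (1 + 1)) (AdeleRing (𝓞 E) E)) 0 1 =
        (b : Matrix (Fin (1 + 1)) (Fin (1 + 1)) (AdeleRing (𝓞 E) E)) 1 0 + (b : Matrix (Fin (1 + 1)) (Fin (1 + 1)) (AdeleRing (𝓞 E) E)) 1 1 →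
      adelicMpCont.proj F (Fin (n + n)) (doubledGramFin F (adelicGram F e TV TW)) p = j ⟨b, hb⟩ →
      ‖E'' (adelicMpCont.omega F (Fin (n + n)) (doubledGramFin F (adelicGram F e TV TW)) p Φ)‖ ≤
        Mbound * Real.sqrt (adelicMpCont.l2Scaling F (doubledGramFin F (adelicGram F e TV TW))
          (isUnit_det_doubledGramFin F (adelicGram F e TV TW) (isUnit_det_adelicGram F e hVd hWd)) ν p).toReal :=
  E2SWBorelBoundFrameHom.exists_borelBound_frame_of_hom F E c hcδ hδ hd N e TW hV hW2 hVd hWd h2 hTW hTs ν E'' Φ u₀ hu₀ jS hjS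
    j hj hINV
    ((hTe ▸ pairSplitting F E c N (1 + 1)
          (((Equiv.prodCongr (Equiv.refl (Fin N)) finSumFinEquiv.symm).trans (Equiv.prodSumDistrib (Fin N) (Fin 1) (Fin 1))).trans
            ((Equiv.sumCongr e e).trans finSumFinEquiv))
          (TV.map (algebraMap F E)) ((Matrix.reindex finSumFinEquiv finSumFinEquiv (Matrix.fromBlocks TW 0 0 (-TW))).map (algebraMap F E)) s₀ :
          ↥(UnitaryGroup.adelic F E c N (TV.map (algebraMap F E))) × ↥(UnitaryGroup.adelic F E c (1 + 1)
        ((Matrix.reindex finSumFinEquiv finSumFinEquiv (Matrix.fromBlocks TW 0 0 (-TW))).map (algebraMap F E))) →* adelicMpCont F (Fin (n + n)) (doubledGramFin F (adelicGram F e TV TW))).comp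
      (MonoidHom.inr _ _))
    (continuous_coe_cast_pairSplitting_inr F E c N e TW hTe s₀ hsc)
    (proj_cast_pairSplitting_inr_apply F E c hcδ hδ hd N e TW hV hW2 hVd hWDd hTe s₀ hcompat)
    (dominated_comp_inr F E c N e TW Φ _ _ hdom)
    hSr hSrdet EI EE κ hκ hsplit Ω L cI hcI hI h𝒴 hL hEE hEEmono hn

end Summit.HodgeConjecture.HodgeConjecture.Cruxes.H413.E2SWBorelBoundSplitting

end
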